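import Literature.Analysis.FluidPDE.Ferrari1993H3BoundHolds
import Literature.Analysis.FluidPDE.KatoLaiUniformExistenceProofs
import HarnessLib

/-!
# Ferrari 1993: continuation past a time of bounded vorticity in the periodic cylinder —
# the discharge `Ferrari1993_periodicCylinderContinuation_holds`

Analysis/FluidPDE. A. B. Ferrari, *On the blow-up of solutions of the 3-D Euler equations in a
bounded domain*, Comm. Math. Phys. **155** (1993) 277–294, Thm 2 (p. 279) with its proof
(pp. 279–283), transported to the periodic cylinder `{r ≤ 1} × ℝ/Lℤ`: a solution of the
periodic class on `[0, T)` whose vorticity stays bounded continues to a solution on a longer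
interval. The
tree reduced this named fact (`Ferrari1993_periodicCylinderContinuation`,
`ChenHouContinuationProofs.lean`) to two analytic leaves — Ferrari's a-priori `H³` bound
(discharged in `Ferrari1993H3BoundHolds.lean`) and Kato–Lai's uniform-time existence
`KatoLai1984_periodicCylinderUniformExistence` — by
`Ferrari1993_periodicCylinderContinuation_of_uniformExistence`; the second leaf is discharged in
`KatoLaiUniformExistenceProofs.lean` (`KatoLai1984_periodicCylinderUniformExistence_holds`, the
energy-method construction of Kato–Lai 1984 carried out on the periodic cylinder). This file is the
resulting one-line discharge; it lives downstream of both (the statement file is upstream of the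
construction).

Everything is proved; no named fact and no `sorry` is introduced.

## References

* A. B. Ferrari, Comm. Math. Phys. 155 (1993) 277–294, Thm 2 (p. 279), pp. 279–283. [Ferrari1993]
* T. Kato, C. Y. Lai, J. Funct. Anal. 56 (1984) 15–28, Thm I, Thm II. [KatoLai1984]
-/

namespace Literature.Analysis.FluidPDE

/-- **Ferrari's continuation criterion in the periodic cylinder** (discharge of
`Ferrari1993_periodicCylinderContinuation`): from the a-priori `H³` bound and Kato–Lai's
uniform-time existence, both proved. [cite: Ferrari1993, Thm 2 (p. 279) and its proof pp. 279–283] -/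
theorem Ferrari1993_periodicCylinderContinuation_holds : Ferrari1993_periodicCylinderContinuation :=
  Ferrari1993_periodicCylinderContinuation_of_uniformExistence
    KatoLai1984_periodicCylinderUniformExistence_holds

/-- **The BKM criterion in the periodic cylinder**, unconditionally. [cite: Ferrari1993, Thms 1–2 (p. 279)] -/
theorem Ferrari1993_periodicCylinderEulerBKM_holds : Ferrari1993_periodicCylinderEulerBKM :=
  Ferrari1993_periodicCylinderEulerBKM_of_uniformExistence
    KatoLai1984_periodicCylinderUniformExistence_holds

end Literature.Analysis.FluidPDE
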